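import Literature.MathematicalPhysics.QuantumFieldTheory.Balaban1983to89.BlockAveraging
import Literature.MathematicalPhysics.QuantumFieldTheory.Balaban1983to89.B10Eq47AxialChi
import Literature.MathematicalPhysics.QuantumFieldTheory.Balaban1983to89.TorusHypercubicSymmetry
import Summits.QuantumFields.BalabanUV.T4Continuum.Spine.NE7.QLaAbelianBlockModel
import HarnessLib

/-!
# Route `UnitScaleTilt`, crux K1 child «MinimiserStabilityRegPr» (stmt-QuantumFields-19200), stub `stub_avgActionDefect` — helper 2:
# THE FOUR (0.4) LOOPS AROUND A COARSE PLAQUETTE CONCATENATE TO A CONJUGATE OF THE `L × L` SQUARE HOLONOMY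

Cell `ym3-torus` (HUMAN RULING D-0037, YM ladder rung R3), seat `ym3-torus-p1` gen 8 (UV side).  Pure lattice geometry of Bałaban's
(0.4) block averaging [Balaban1987RG1]: `Ū(c) = corr(c)·U(c)` with `corr(c)` the small-loop average of the loop variables
`W_c(x, Γ, Γ′) = U(Γ ∪ [x,x′] ∪ (−Γ′) ∪ (−c))` (tree `BlockAveraging.loopHol`, index `(r, σ, σ′) ∈ Idx P`).

* §1 straight walks from an arbitrary base: `holAt_walk_replicate` (= `B10Eq47AxialChi.rowProd`), `walkEnd_replicate`, `shiftN_apply`.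
* §2 `blockSite_shift` (`blockSite (y+e_μ) r = blockSite y r + Le_μ` as an iterated shift, standing range); the staircase end point
  `emb y + n(r) = blockSite y r` is the tree's `NE7.walkEnd_emb_stairWord` (`QLaAbelianBlockModel`).
* §3 **`loopHol_eq`**: `W_c(r, σ, σ′) = U(Γ^σ_{c₋,r}) · U([x_r, x_r + Le_μ]) · U(Γ^{σ′}_{c₊,r})⁻¹ · U(c)⁻¹` with `x_r = blockSite c₋ r`.
* §4 **`fourLoops_eq_conj_rect`**: for a coarse plaquette `p′ = (y; μ < ν)` and matched orderings `(σ₀, σ₁, σ₂, σ₃)`,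
  `W₁U(c₁) · W₂U(c₂) · (W₃U(c₃))⁻¹ · (W₄U(c₄))⁻¹ = U(Γ^{σ₀}) · U(∂R_{L,L}(x_r)) · U(Γ^{σ₀})⁻¹` where
  `W₁ = W_{c₁}(r,σ₀,σ₁)`, `W₂ = W_{c₂}(r,σ₁,σ₂)`, `W₃ = W_{c₃}(r,σ₃,σ₂)`, `W₄ = W_{c₄}(r,σ₀,σ₃)` (`c₁ = ⟨y,μ⟩`, `c₂ = ⟨y+e_μ,ν⟩`,
  `c₃ = ⟨y+e_ν,μ⟩`, `c₄ = ⟨y,ν⟩`) — all staircases cancel pairwise; hence **`dist1_fourLoops_le`**: its distance to `1` is at most the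
  SUM of `|U(∂p) − 1|` over the `L²` fine plaquettes of the square based at `x_r` (tree `B10Eq47AxialChi.dist1_rect_le`).

This is the combinatorial heart of the located gap G-K1a-3b′: to first order the coarse plaquette of the averaged field is the MEAN over
`x ∈ B(y)` of the (transported) `L × L` square holonomies at `x`.
-/

noncomputable section

open scoped BigOperators

namespace Summit.QuantumFields.YangMills.Theorems.AvgActionDefect

open Literature.MathematicalPhysics.QuantumFieldTheory.Balaban1983to89
open T4Continuum BlockAveraging AveragingRT B10Eq47AxialChi
open Summit.QuantumFields.BalabanUV.T4Continuum.Spine.NE7 (walkEnd_emb_stairWord walkEnd_blockSite_replicate)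

variable {P : Params} {j : ℕ} {G : Type*} [GaugeGroup G]

/-! ## §1 Straight walks from an arbitrary base site -/

/-- `shiftN (x + e_μ) μ n = (shiftN x μ n) + e_μ`. [folklore] -/
theorem shiftN_shift_self (x : Site P j) (μ : Fin P.d) : ∀ n : ℕ, shiftN (x.shift μ) μ n = (shiftN x μ n).shift μ
  | 0 => rfl
  | n + 1 => by rw [shiftN_succ, shiftN_succ, shiftN_shift_self x μ n]

/-- Coordinates of an iterated shift: `(x + n e_μ)_ν = x_ν + n·[ν = μ]`. [folklore] -/
theorem shiftN_apply (x : Site P j) (μ : Fin P.d) : ∀ (n : ℕ) (ν : Fin P.d),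
    shiftN x μ n ν = x ν + if ν = μ then (n : ZMod (P.sitesPerDir j)) else 0
  | 0, ν => by simp
  | n + 1, ν => by
    rw [shiftN_succ, Site.shift_apply, shiftN_apply x μ n μ, shiftN_apply x μ n ν]
    by_cases h : ν = μ
    · subst h; simp only [if_true]; push_cast; ring
    · simp [h]

/-- `rowProd` from the left: `U(x,…,x+(n+1)e_μ) = U(x, x+e_μ) · U(x+e_μ, …)`. [folklore] -/
theorem rowProd_succ_left (U : GaugeField P j G) (x : Site P j) (μ : Fin P.d) :
    ∀ n : ℕ, rowProd U x μ (n + 1) = U ⟨x, μ⟩ * rowProd U (x.shift μ) μ n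
  | 0 => by simp [rowProd]
  | n + 1 => by
    rw [rowProd_succ, rowProd_succ_left U x μ n, rowProd_succ, shiftN_shift_self, mul_assoc]
    rfl

/-- The straight walk of `n` steps `+e_μ` from `x` ends at `x + n e_μ`. [folklore] -/
theorem walkEnd_replicate (x : Site P j) (μ : Fin P.d) : ∀ n : ℕ,
    walkEnd x (List.replicate n (μ, true)) = shiftN x μ n
  | 0 => rfl
  | n + 1 => by
    rw [List.replicate_succ]
    show walkEnd (x.shift μ) (List.replicate n (μ, true)) = _
    rw [walkEnd_replicate (x.shift μ) μ n, shiftN_shift_self, shiftN_succ]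

/-- **The holonomy of the straight walk of `n` steps `+e_μ` from `x` is the row product** `rowProd U x μ n`. [folklore] -/
theorem holAt_walk_replicate (U : GaugeField P j G) (μ : Fin P.d) : ∀ (n : ℕ) (x : Site P j),
    holAt U (walk x (List.replicate n (μ, true))) = rowProd U x μ n
  | 0, x => by simp [walk, holAt_nil, rowProd]
  | n + 1, x => by
    rw [List.replicate_succ, rowProd_succ_left]
    show holAt U (⟨⟨x, μ⟩, true⟩ :: walk (x.shift μ) (List.replicate n (μ, true))) = _
    rw [holAt_cons, holAt_walk_replicate U μ n (x.shift μ)]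
    rfl

/-! ## §2 The block sites of neighbouring blocks -/

/-- `blockSite (y + e_μ) r = blockSite y r + L e_μ` (standing range). [folklore] -/
theorem blockSite_shift (hj : j + 1 ≤ P.m + P.K) (y : Site P (j + 1)) (μ : Fin P.d) (r : Fin P.d → Fin P.L) :
    Site.blockSite (y.shift μ) r = shiftN (Site.blockSite y r) μ P.L := by
  rw [← walkEnd_emb_stairWord (y.shift μ) 1 r, ← walkEnd_emb_stairWord y 1 r]
  funext ν
  rw [walkEnd_apply, shiftN_apply, walkEnd_apply, emb_shift hj, shiftN_apply]
  by_cases h : ν = μ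
  · subst h; simp only [if_true]; ring
  · simp [h]

/-! ## §3 The loop variables of (0.4) factorised -/

/-- **THE (0.4) LOOP VARIABLE FACTORISED** (standing range): for `c = ⟨y, μ⟩` and index `(r, σ, σ′)`,
`W_c(r,σ,σ′) = U(Γ^σ_{y,r}) · U([x_r, x_r + L e_μ]) · U(Γ^{σ′}_{y+e_μ,r})⁻¹ · U(c)⁻¹`, where `x_r = blockSite y r`, the staircase
holonomies are `holAt U (walk (emb ·) (stairWord · (off r)))`, the transported bond is the row product `rowProd U x_r μ L`, and `U(c)`
is the straight transporter `axialAvg U c`. [cite: Balaban1987RG1, (0.4) p.253] -/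
theorem loopHol_eq (hj : j + 1 ≤ P.m + P.K) (U : GaugeField P j G) (c : PBond P (j + 1))
    (r : Fin P.d → Fin P.L) (σ σ' : Equiv.Perm (Fin P.d)) :
    loopHol U c (r, σ, σ') =
      holAt U (walk (emb c.src) (stairWord σ (off r))) * rowProd U (Site.blockSite c.src r) c.dir P.L *
        (holAt U (walk (emb c.tgt) (stairWord σ' (off r))))⁻¹ * (axialAvg U c)⁻¹ := by
  unfold loopHol loopWord
  simp only
  rw [walk_append, holAt_append, walk_append, holAt_append, walk_append, holAt_append]
  have h1 : walkEnd (emb c.src) (stairWord σ (off r)) = Site.blockSite c.src r := walkEnd_emb_stairWord _ _ _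
  have h2 : walkEnd (Site.blockSite c.src r) (List.replicate P.L (c.dir, true)) =
      walkEnd (emb c.tgt) (stairWord σ' (off r)) := by
    rw [walkEnd_blockSite_replicate hj, walkEnd_emb_stairWord]
    rfl
  have h3 : walkEnd (walkEnd (emb c.tgt) (stairWord σ' (off r))) (wordRev (stairWord σ' (off r))) = emb c.tgt :=
    walkEnd_walkEnd_wordRev _ _
  have h4 : holAt U (walk (emb c.tgt) (List.replicate P.L (c.dir, false))) = (axialAvg U c)⁻¹ := by
    rw [axialAvg_eq_holAt_walk, ← holAt_walk_wordRev, walkEnd_replicate_L, wordRev_replicate]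
    rfl
  rw [h1, h2, holAt_walk_wordRev, h3, h4, holAt_walk_replicate, ← mul_assoc, ← mul_assoc]

/-! ## §4 The four loops around a coarse plaquette -/

/-- **THE FOUR (0.4) LOOPS AROUND A COARSE PLAQUETTE WITH MATCHED STAIRCASES CONCATENATE TO A CONJUGATE OF THE BIG SQUARE**
(standing range): for `p′ = (y; μ < ν)`, offsets `r` and orderings `σ₀, σ₁, σ₂, σ₃`, with `c₁ = ⟨y,μ⟩`, `c₂ = ⟨y+e_μ,ν⟩`,
`c₃ = ⟨y+e_ν,μ⟩`, `c₄ = ⟨y,ν⟩`, `W₁ = W_{c₁}(r,σ₀,σ₁)`, `W₂ = W_{c₂}(r,σ₁,σ₂)`, `W₃ = W_{c₃}(r,σ₃,σ₂)`, `W₄ = W_{c₄}(r,σ₀,σ₃)`: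
`W₁U(c₁)·W₂U(c₂)·(W₃U(c₃))⁻¹·(W₄U(c₄))⁻¹ = U(Γ^{σ₀}_{y,r}) · U(∂R_{L,L}(blockSite y r; μ, ν)) · U(Γ^{σ₀}_{y,r})⁻¹` — every staircase
cancels against its partner in the neighbouring loop. [cite: Balaban1987RG1, (0.4) p.253] -/
theorem fourLoops_eq_conj_rect (hj : j + 1 ≤ P.m + P.K) (U : GaugeField P j G) (p : Plaq P (j + 1))
    (r : Fin P.d → Fin P.L) (σ₀ σ₁ σ₂ σ₃ : Equiv.Perm (Fin P.d)) :
    loopHol U ⟨p.src, p.μ⟩ (r, σ₀, σ₁) * axialAvg U ⟨p.src, p.μ⟩ *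
        (loopHol U ⟨p.src.shift p.μ, p.ν⟩ (r, σ₁, σ₂) * axialAvg U ⟨p.src.shift p.μ, p.ν⟩) *
        (loopHol U ⟨p.src.shift p.ν, p.μ⟩ (r, σ₃, σ₂) * axialAvg U ⟨p.src.shift p.ν, p.μ⟩)⁻¹ *
        (loopHol U ⟨p.src, p.ν⟩ (r, σ₀, σ₃) * axialAvg U ⟨p.src, p.ν⟩)⁻¹ =
      holAt U (walk (emb p.src) (stairWord σ₀ (off r))) * rect U (Site.blockSite p.src r) p.μ p.ν P.L P.L *
        (holAt U (walk (emb p.src) (stairWord σ₀ (off r))))⁻¹ := by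
  rw [loopHol_eq hj, loopHol_eq hj, loopHol_eq hj, loopHol_eq hj]
  simp only [PBond.tgt]
  rw [Site.shift_comm p.src p.ν p.μ, blockSite_shift hj, blockSite_shift hj, rect]
  -- abbreviate the group elements and finish in the free group
  generalize holAt U (walk (emb p.src) (stairWord σ₀ (off r))) = S₀
  generalize holAt U (walk (emb (p.src.shift p.μ)) (stairWord σ₁ (off r))) = S₁
  generalize holAt U (walk (emb ((p.src.shift p.μ).shift p.ν)) (stairWord σ₂ (off r))) = S₂
  generalize holAt U (walk (emb (p.src.shift p.ν)) (stairWord σ₃ (off r))) = S₃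
  generalize rowProd U (Site.blockSite p.src r) p.μ P.L = M₁
  generalize rowProd U (shiftN (Site.blockSite p.src r) p.μ P.L) p.ν P.L = N₂
  generalize rowProd U (shiftN (Site.blockSite p.src r) p.ν P.L) p.μ P.L = M₃
  generalize rowProd U (Site.blockSite p.src r) p.ν P.L = N₄
  generalize axialAvg U ⟨p.src, p.μ⟩ = A₁
  generalize axialAvg U ⟨p.src.shift p.μ, p.ν⟩ = A₂
  generalize axialAvg U ⟨p.src.shift p.ν, p.μ⟩ = A₃
  generalize axialAvg U ⟨p.src, p.ν⟩ = A₄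
  group

/-- **HENCE ITS DISTANCE TO `1` IS AT MOST THE SUM OVER THE `L × L` FINE PLAQUETTES OF THE SQUARE AT `blockSite y r`** of
`|U(∂p) − 1|` (conjugation invariance (19)–(20) of [Balaban1985Averaging] and the tree's non-abelian Stokes `dist1_rect_le`).
[cite: Balaban1985Averaging, (19)-(20) p.21] -/
theorem dist1_fourLoops_le (hj : j + 1 ≤ P.m + P.K) (U : GaugeField P j G) (p : Plaq P (j + 1))
    (r : Fin P.d → Fin P.L) (σ₀ σ₁ σ₂ σ₃ : Equiv.Perm (Fin P.d)) :
    dist1 (loopHol U ⟨p.src, p.μ⟩ (r, σ₀, σ₁) * axialAvg U ⟨p.src, p.μ⟩ *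
        (loopHol U ⟨p.src.shift p.μ, p.ν⟩ (r, σ₁, σ₂) * axialAvg U ⟨p.src.shift p.μ, p.ν⟩) *
        (loopHol U ⟨p.src.shift p.ν, p.μ⟩ (r, σ₃, σ₂) * axialAvg U ⟨p.src.shift p.ν, p.μ⟩)⁻¹ *
        (loopHol U ⟨p.src, p.ν⟩ (r, σ₀, σ₃) * axialAvg U ⟨p.src, p.ν⟩)⁻¹) ≤
      ∑ t ∈ Finset.range P.L, ∑ s ∈ Finset.range P.L,
        dist1 (GaugeField.plaqHol U ⟨shiftN (shiftN (Site.blockSite p.src r) p.ν t) p.μ s, p.μ, p.ν, p.hμν⟩) := by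
  rw [fourLoops_eq_conj_rect hj, GaugeGroup.dist1_conj]
  exact dist1_rect_le U _ p.hμν P.L P.L

end Summit.QuantumFields.YangMills.Theorems.AvgActionDefect

end
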